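import Mathlib.Tactic.Linarith
import Mathlib.Tactic.Ring
import Mathlib.Order.Basic
import HarnessLib

/-!
# Venture HSemireg — unit spread: the tree half of LEMMA US

Elementary combinatorics behind «LEMMA US» of the computation cell `pub-hsemireg` (seat
w1-aut-2, `widen/W1/UNITSPREAD-w1aut2.md` §1; origin: w1-cx-1, `cx1/W1-CX-MASSEY3.md` §5bis (b);
machine use: the value filter of `h3unit.py`, TABLE-W1 rows W1AUT-B30…).

Setting on paper (NOT in this file): in a STRICTLY UNITAL A∞-category the higher products
`m_r`, `r ≥ 3`, vanish when an argument is a strict unit, while `m₂(1,u) = ±u`. A summand of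
the tensor-product formula for `m_N` evaluates, in one slot, the operation of a planar rooted
tree with `N` leaves (vertices of arity `r ≥ 2` carry `m_r`); its degree is `−dim` with
`dim = Σ_v (r_v − 2)`. If some of the leaves are units, the summand SURVIVES strict unitality
only if no vertex of arity `≥ 3` receives an argument that evaluates to a unit, where a subtree
evaluates to a unit iff it is a unit leaf or a binary vertex both of whose inputs evaluate to
units (`m₂(1,1) = 1`). LEMMA US says: a surviving summand that is not itself a unit has
`dim ≤ max(0, ν − 2)`, `ν ≥ 1` the number of NON-unit leaves — so the degree a slot can drop is
bounded by its non-unit leaves, whatever the total arity `N`.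

What is recorded (pure tree combinatorics; the A∞ axioms enter only as the DEFINITION of
`Survives` / `unitVal` below, which is the paper's dictionary, not a theorem about categories):

* `Tree` / `Forest` — planar rooted trees with leaves marked unit (`true`) or not, as a mutual
  inductive; `leaves`, `nonunits`, `dim`, `verts`, the arity of a vertex = length of its forest;
* `Tree.WF` — every vertex has arity `≥ 2` (faces of associahedra);
* `Tree.unitVal` — «evaluates to a unit»; `Tree.Survives` — «not killed by strict unitality»;
* `leaves_eq` — the counting identity `#leaves = dim + #vertices + 1` (so `dim ≤ #leaves − 2`
  as soon as there is a vertex: the top cell of `K_N` has dimension `N − 2`);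
* `unit_spread` — **LEMMA US (tree half)**: a well-formed surviving tree either evaluates to a
  unit, and then `dim = 0` and it has no non-unit leaf, or it has `ν ≥ 1` non-unit leaves and
  `dim + 2 ≤ max 2 ν`, i.e. `dim ≤ max(0, ν − 2)`.

HONEST FRAMING. Counting on finite trees only; the Lean index of one step of a MODEL-LEVEL
necessary-condition filter used by the cell (its soundness for the cell's first-order equation is
a separate, unread question, MASSEY3 §5bis (a)). No category, sheaf, complex or abelian variety
appears; nothing here says that HC, HC_CM or HC_AV holds, and nothing here is a new case of
anything.
-/

namespace Summit.Ventures.HSemireg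

namespace UnitSpread

mutual
/-- Planar rooted trees with marked leaves: `leaf true` is a unit leaf, `leaf false` a non-unit
leaf, `node f` a vertex whose ordered inputs are the forest `f`. -/
inductive Tree : Type
  | leaf : Bool → Tree
  | node : Forest → Tree
/-- Ordered lists of trees (the inputs of a vertex). -/
inductive Forest : Type
  | nil : Forest
  | cons : Tree → Forest → Forest
end

mutual
/-- Number of leaves. -/
def Tree.leaves : Tree → ℕ
  | .leaf _ => 1
  | .node f => f.leaves
/-- Number of leaves of a forest. -/
def Forest.leaves : Forest → ℕ
  | .nil => 0
  | .cons t f => t.leaves + f.leaves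
end

mutual
/-- Number of NON-unit leaves (`ν` on paper). -/
def Tree.nonunits : Tree → ℕ
  | .leaf b => if b then 0 else 1
  | .node f => f.nonunits
/-- Number of non-unit leaves of a forest. -/
def Forest.nonunits : Forest → ℕ
  | .nil => 0
  | .cons t f => t.nonunits + f.nonunits
end

/-- Arity of a vertex = number of trees in its input forest. -/
def Forest.len : Forest → ℕ
  | .nil => 0
  | .cons _ f => f.len + 1

mutual
/-- Number of vertices (internal nodes). -/
def Tree.verts : Tree → ℕ
  | .leaf _ => 0
  | .node f => f.verts + 1
/-- Number of vertices in a forest. -/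
def Forest.verts : Forest → ℕ
  | .nil => 0
  | .cons t f => t.verts + f.verts
end

mutual
/-- Dimension `Σ_v (arity v − 2)` (an integer; for well-formed trees it is `≥ 0`). -/
def Tree.dim : Tree → ℤ
  | .leaf _ => 0
  | .node f => (f.len : ℤ) - 2 + f.dim
/-- Sum of the dimensions of the trees of a forest. -/
def Forest.dim : Forest → ℤ
  | .nil => 0
  | .cons t f => t.dim + f.dim
end

mutual
/-- Well-formed: every vertex has arity at least `2`. -/
def Tree.WF : Tree → Prop
  | .leaf _ => True
  | .node f => 2 ≤ f.len ∧ f.WF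
/-- All trees of the forest are well-formed. -/
def Forest.WF : Forest → Prop
  | .nil => True
  | .cons t f => t.WF ∧ f.WF
end

mutual
/-- «Evaluates to a unit»: a unit leaf, or a BINARY vertex both of whose inputs evaluate to
units (`m₂(1,1) = 1`). -/
def Tree.unitVal : Tree → Bool
  | .leaf b => b
  | .node f => decide (f.len = 2) && f.allUnit
/-- Every tree of the forest evaluates to a unit. -/
def Forest.allUnit : Forest → Bool
  | .nil => true
  | .cons t f => t.unitVal && f.allUnit
end

/-- No tree of the forest evaluates to a unit. -/
def Forest.noUnit : Forest → Prop
  | .nil => True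
  | .cons t f => t.unitVal = false ∧ f.noUnit

mutual
/-- «Survives strict unitality»: every vertex of arity `≥ 3` has no input evaluating to a unit
(`m_r(…,1,…) = 0` for `r ≥ 3`), recursively. -/
def Tree.Survives : Tree → Prop
  | .leaf _ => True
  | .node f => f.Survives ∧ (3 ≤ f.len → f.noUnit)
/-- Every tree of the forest survives. -/
def Forest.Survives : Forest → Prop
  | .nil => True
  | .cons t f => t.Survives ∧ f.Survives
end

/-! ### The counting identity -/

mutual
/-- `#leaves = dim + #vertices + 1` for a tree. -/
theorem Tree.leaves_eq : ∀ t : Tree, (t.leaves : ℤ) = t.dim + t.verts + 1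
  | .leaf _ => by simp [Tree.leaves, Tree.dim, Tree.verts]
  | .node f => by
      have h := Forest.leaves_eq f
      simp only [Tree.leaves, Tree.dim, Tree.verts, Nat.cast_add, Nat.cast_one]
      linarith
/-- `#leaves = dim + #vertices + #trees` for a forest. -/
theorem Forest.leaves_eq : ∀ f : Forest, (f.leaves : ℤ) = f.dim + f.verts + f.len
  | .nil => by simp [Forest.leaves, Forest.dim, Forest.verts, Forest.len]
  | .cons t f => by
      have ht := Tree.leaves_eq t
      have hf := Forest.leaves_eq f
      simp only [Forest.leaves, Forest.dim, Forest.verts, Forest.len, Nat.cast_add, Nat.cast_one]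
      linarith
end

/-- A tree with at least one vertex has `dim ≤ #leaves − 2` (the top cell of the associahedron
`K_N` has dimension `N − 2`). -/
theorem Tree.dim_le_leaves_sub_two (t : Tree) (h : 1 ≤ t.verts) :
    t.dim ≤ (t.leaves : ℤ) - 2 := by
  have := t.leaves_eq
  have hv : (1 : ℤ) ≤ t.verts := by exact_mod_cast h
  linarith

/-! ### LEMMA US, tree half -/

/-- Auxiliary statement proved by mutual induction: the unit case and the non-unit case. -/
def Tree.USpec (t : Tree) : Prop :=
  (t.unitVal = true → t.dim = 0 ∧ t.nonunits = 0) ∧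
  (t.unitVal = false → 1 ≤ t.nonunits ∧ t.dim + 2 ≤ max 2 (t.nonunits : ℤ))

/-- Forest version: if no tree of a surviving well-formed forest evaluates to a unit, then
`dim + #trees ≤ #non-unit leaves`. -/
def Forest.USpec (f : Forest) : Prop :=
  (f.noUnit → f.dim + f.len ≤ (f.nonunits : ℤ) ∧ f.len ≤ f.nonunits) ∧
  (f.allUnit = true → f.dim = 0 ∧ f.nonunits = 0)

mutual
/-- LEMMA US, tree half (tree case of the mutual induction): a well-formed tree that survives strict unitality
satisfies `USpec` (it is a unit, or `dim ≤ max 0 (nonunits − 2)` with `nonunits ≥ 1`). -/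
theorem Tree.uspec : ∀ t : Tree, t.WF → t.Survives → t.USpec
  | .leaf b => by
      intro _ _
      constructor
      · intro h; cases b <;> simp_all [Tree.unitVal, Tree.dim, Tree.nonunits]
      · intro h; cases b <;> simp_all [Tree.unitVal, Tree.dim, Tree.nonunits]
  | .node f => by
      intro hwf hs
      simp only [Tree.WF] at hwf
      simp only [Tree.Survives] at hs
      obtain ⟨hlen, hwfF⟩ := hwf
      obtain ⟨hsF, h3⟩ := hs
      have hF := Forest.uspec f hwfF hsF
      constructor
      · -- the vertex evaluates to a unit: binary with all-unit inputs
        intro hu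
        simp only [Tree.unitVal, Bool.and_eq_true, decide_eq_true_eq] at hu
        obtain ⟨h2, hall⟩ := hu
        obtain ⟨hd, hn⟩ := hF.2 hall
        refine ⟨?_, ?_⟩
        · simp only [Tree.dim, h2, hd]; norm_num
        · simpa [Tree.nonunits] using hn
      · intro hnu
        -- either arity ≥ 3 (then no unit inputs), or binary with not all inputs units
        by_cases h3' : 3 ≤ f.len
        · have hno := h3 h3'
          obtain ⟨hd, hl⟩ := hF.1 hno
          refine ⟨?_, ?_⟩
          · simp only [Tree.nonunits]; omega
          · simp only [Tree.dim, Tree.nonunits]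
            have : (3 : ℤ) ≤ f.len := by exact_mod_cast h3'
            have hl' : (f.len : ℤ) ≤ f.nonunits := by exact_mod_cast hl
            rw [max_eq_right (by linarith)]
            linarith
        · -- binary vertex
          have h2 : f.len = 2 := by omega
          exact Forest.binary_case f h2 hwfF hsF (by
            simp only [Tree.unitVal, h2, decide_true, Bool.true_and] at hnu; exact hnu)
/-- LEMMA US, tree half (forest case of the mutual induction): the `USpec` bookkeeping for a well-formed
surviving forest (the list of children of a vertex). -/
theorem Forest.uspec : ∀ f : Forest, f.WF → f.Survives → f.USpec
  | .nil => by
      intro _ _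
      constructor
      · intro _; simp [Forest.dim, Forest.len, Forest.nonunits]
      · intro _; simp [Forest.dim, Forest.nonunits]
  | .cons t f => by
      intro hwf hs
      simp only [Forest.WF] at hwf
      simp only [Forest.Survives] at hs
      have ht := Tree.uspec t hwf.1 hs.1
      have hf := Forest.uspec f hwf.2 hs.2
      constructor
      · intro hno
        simp only [Forest.noUnit] at hno
        obtain ⟨htu, hfu⟩ := hno
        obtain ⟨hn1, hd1⟩ := ht.2 htu
        obtain ⟨hd2, hl2⟩ := hf.1 hfu
        have hmax : max 2 (t.nonunits : ℤ) ≤ t.nonunits + 1 := by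
          have : (1 : ℤ) ≤ t.nonunits := by exact_mod_cast hn1
          exact max_le (by linarith) (by linarith)
        refine ⟨?_, ?_⟩
        · simp only [Forest.dim, Forest.len, Forest.nonunits, Nat.cast_add, Nat.cast_one]
          linarith
        · simp only [Forest.len, Forest.nonunits]; omega
      · intro hall
        simp only [Forest.allUnit, Bool.and_eq_true] at hall
        obtain ⟨hd1, hn1⟩ := ht.1 hall.1
        obtain ⟨hd2, hn2⟩ := hf.2 hall.2
        exact ⟨by simp [Forest.dim, hd1, hd2], by simp [Forest.nonunits, hn1, hn2]⟩
/-- The binary vertex whose inputs do not both evaluate to units. -/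
theorem Forest.binary_case : ∀ f : Forest, f.len = 2 → f.WF → f.Survives → f.allUnit = false →
    1 ≤ (Tree.node f).nonunits ∧ (Tree.node f).dim + 2 ≤ max 2 ((Tree.node f).nonunits : ℤ)
  | .nil => by intro h; simp [Forest.len] at h
  | .cons a .nil => by intro h; simp [Forest.len] at h
  | .cons a (.cons b (.cons c g)) => by intro h; simp [Forest.len] at h
  | .cons a (.cons b .nil) => by
      intro _ hwf hs hall
      simp only [Forest.WF] at hwf
      simp only [Forest.Survives] at hs
      have ha := Tree.uspec a hwf.1 hs.1
      have hb := Tree.uspec b hwf.2.1 hs.2.1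
      have hn : (Tree.node (.cons a (.cons b .nil))).nonunits = a.nonunits + b.nonunits := by
        simp [Tree.nonunits, Forest.nonunits]
      have hd : (Tree.node (.cons a (.cons b .nil))).dim = a.dim + b.dim := by
        simp only [Tree.dim, Forest.dim, Forest.len]; push_cast; ring
      rw [hn, hd]
      simp only [Forest.allUnit, Bool.and_true, Bool.and_eq_false_iff] at hall
      -- case analysis on which input is a unit
      cases hau : a.unitVal <;> cases hbu : b.unitVal
      · -- neither is a unit
        obtain ⟨na, da⟩ := ha.2 hau
        obtain ⟨nb, db⟩ := hb.2 hbu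
        have hma : max 2 (a.nonunits : ℤ) ≤ a.nonunits + 1 :=
          max_le (by exact_mod_cast Nat.succ_le_succ na) (by linarith)
        have hmb : max 2 (b.nonunits : ℤ) ≤ b.nonunits + 1 :=
          max_le (by exact_mod_cast Nat.succ_le_succ nb) (by linarith)
        refine ⟨by omega, le_trans ?_ (le_max_right _ _)⟩
        push_cast
        linarith
      · -- a non-unit, b unit
        obtain ⟨na, da⟩ := ha.2 hau
        obtain ⟨db, nb⟩ := hb.1 hbu
        exact ⟨by omega, by simpa [nb, db] using da⟩
      · -- a unit, b non-unit
        obtain ⟨da, na⟩ := ha.1 hau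
        obtain ⟨nb, db⟩ := hb.2 hbu
        exact ⟨by omega, by simpa [na, da] using db⟩
      · -- both units: excluded by `hall`
        exact absurd hbu (by simpa [hau] using hall)
end

/-- **LEMMA US (tree half).** A well-formed tree (all arities `≥ 2`) that survives strict
unitality and does not evaluate to a unit has at least one non-unit leaf, and its dimension — the
degree its slot operation drops — is at most `max(0, ν − 2)`, `ν` the number of non-unit leaves.
-/
theorem unit_spread (t : Tree) (hwf : t.WF) (hs : t.Survives) (hu : t.unitVal = false) :
    1 ≤ t.nonunits ∧ t.dim ≤ max 0 ((t.nonunits : ℤ) - 2) := by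
  obtain ⟨hn, hd⟩ := (t.uspec hwf hs).2 hu
  refine ⟨hn, ?_⟩
  rcases le_total 2 (t.nonunits : ℤ) with h | h
  · rw [max_eq_right h] at hd; rw [max_eq_right (by linarith)]; linarith
  · rw [max_eq_left h] at hd; rw [max_eq_left (by linarith)]; linarith

/-- The unit case: a surviving tree that evaluates to a unit has dimension `0` and no non-unit
leaf (it is an iterated `m₂` of units). -/
theorem unit_case (t : Tree) (hwf : t.WF) (hs : t.Survives) (hu : t.unitVal = true) :
    t.dim = 0 ∧ t.nonunits = 0 :=
  (t.uspec hwf hs).1 hu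

/-- Sanity: the corolla `m₃` on three non-unit leaves is well-formed, survives, has `ν = 3` and
`dim = 1 = ν − 2` (the bound is attained). -/
example :
    let t := Tree.node (.cons (.leaf false) (.cons (.leaf false) (.cons (.leaf false) .nil)))
    t.WF ∧ t.Survives ∧ t.nonunits = 3 ∧ t.dim = 1 := by
  refine ⟨?_, ?_, ?_, ?_⟩ <;>
    simp [Tree.WF, Forest.WF, Tree.Survives, Forest.Survives, Forest.noUnit, Forest.len,
      Tree.unitVal, Tree.nonunits, Forest.nonunits, Tree.dim, Forest.dim]

/-- Sanity: `m₃(1, a, b)` does NOT survive (a unit enters a ternary vertex). -/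
example :
    ¬ (Tree.node (.cons (.leaf true) (.cons (.leaf false) (.cons (.leaf false) .nil)))).Survives := by
  simp [Tree.Survives, Forest.Survives, Forest.noUnit, Forest.len, Tree.unitVal]

end UnitSpread

end Summit.Ventures.HSemireg
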